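import Summits.CriticalPhenomena.PercolationContinuityZ3.Theorems.PercNearOneGluingNoHeavyQuantBlockCombTiedPlusRoot
import HarnessLib

/-!
# QUANT lane R8, FAR on trees: the mean of the block-comb count, the MARKOV row in canonical form, and the floor-preserving MERGE of a
# tied root blob

builds on p205010 (kernel theorem, internal audit signed; external expert review pending)

Support file (`--supports stmt-CriticalPhenomena-4575`), QUANT lane seat prim-quant-census-1 (gen 13); memo
`run/shared/lean/prim/quant/prim-quant-census-1/GENERAL-ROW-G13.md`.  Theorems only (local notation, no definitions), no sorries,
standard axioms.  Model and notation: `…QuantBlockCombMergeModel.lean`.  Second of three files (`…RootGateAffine`, `…MarkovMerge`,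
`…GeneralRow`) proving the far-relay row for EVERY block-comb.

* `Quant.BlockComb.sum_pd_total` / `sum_wt_mass_cast` / `tail_mean_eq` — total depth weight and **the mean of the count**
  `Σ_i pd i·Σ_S wt S·mass_i S = Σ_k a k·(∏_{i<lv k} q i)·g k`.
* `Quant.BlockComb.tail_ge_mean_markov` — **Markov for the closed mass** in canonical form: with `n = Σ a > j`,
  `(EN − j)/(n − j) ≤ TAIL` (pointwise `𝟙[N ≥ j+1] ≥ (N − j)/(n − j)`); so FAR holds in the MARKOV REGIME `x·(n − j) ≤ j` whenever
  `EN > 2j` (`Quant.farRelayRow_instance_of_markov`, lead g4, read on the block-comb).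
* `Quant.BlockComb.merge_tied_root` — **the floor-preserving merge**: a live ROOT blob `τ` whose gate IS the floor `x` (every live
  marginal `≥ x`) with `j ≤ x·(Σ a − a τ)` and `a τ < Σ a` is moved by p1 g8's law-free `tail_transfer_le` into another live blob:
  the new size vector has one live blob fewer, live set inside the old one, mean not smaller, tail not larger.  (Outside the giant
  and Markov regimes the hypothesis `j ≤ x·(Σ a − a τ)` is automatic: `a τ ≤ j` and `j < x·(Σ a − j)`.)
-/

namespace Summit.CriticalPhenomena.PercolationContinuityZ3.Theorems

namespace Quant

namespace BlockComb

open Finset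

variable {κ : Type*} [Fintype κ] [DecidableEq κ]

/-- product-Bernoulli weight of the set `S` of open blob gates -/
local notation3 "wt[" g ", " S "]" => ∏ k, (if k ∈ (S : Finset κ) then (g : κ → ℝ) k else 1 - (g : κ → ℝ) k)

/-- probability that the chain `q` of length `D` is open exactly to depth `i` -/
local notation3 "pd[" D ", " q ", " i "]" =>
  (∏ i' ∈ Finset.range (i : ℕ), (q : ℕ → ℝ) i') * (if (i : ℕ) < (D : ℕ) then 1 - (q : ℕ → ℝ) i else 1)

/-- mass counted at depth `i` in blob configuration `S` -/
local notation3 "mass[" lv ", " a ", " i ", " S "]" =>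
  ∑ k ∈ (S : Finset κ).filter (fun k => (lv : κ → ℕ) k ≤ (i : ℕ)), ((a : κ → ℕ) k : ℕ)

/-- the tail `P(N ≥ j+1)` of the block-comb count, as an explicit finite sum -/
local notation3 "TAIL[" D ", " q ", " lv ", " a ", " g ", " j "]" =>
  ∑ i ∈ Finset.range ((D : ℕ) + 1), pd[D, q, i] *
    ∑ S : Finset κ, wt[g, S] * (if (j : ℕ) + 1 ≤ mass[lv, a, i, S] then (1 : ℝ) else 0)

/-! ### 1. Total weights and the mean of the count -/

/-- Total depth weight is one: `Σ_{i ≤ D} pd i = 1`. [folklore] -/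
theorem sum_pd_total (D : ℕ) (q : ℕ → ℝ) : ∑ i ∈ Finset.range (D + 1), pd[D, q, i] = 1 := by
  have h := pd_tail_sum q D 0 (Nat.zero_le D)
  rw [Finset.filter_true_of_mem (fun i _ => Nat.zero_le i), Finset.prod_range_zero] at h
  exact h

/-- The mean of the mass counted at depth `i`: `Σ_S wt S·mass_i S = Σ_{lv k ≤ i} a k·g k`. [folklore] -/
theorem sum_wt_mass_cast (g : κ → ℝ) (lv : κ → ℕ) (a : κ → ℕ) (i : ℕ) :
    ∑ S : Finset κ, wt[g, S] * (mass[lv, a, i, S] : ℝ) =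
      ∑ k ∈ Finset.univ.filter (fun k => lv k ≤ i), (a k : ℝ) * g k := by
  -- the mass as a sum of indicators over a fixed index set
  have hmass : ∀ S : Finset κ, (mass[lv, a, i, S] : ℝ) =
      ∑ k ∈ Finset.univ.filter (fun k => lv k ≤ i), (a k : ℝ) * (if k ∈ S then (1 : ℝ) else 0) := by
    intro S
    have hset : S.filter (fun k => lv k ≤ i) =
        (Finset.univ.filter (fun k => lv k ≤ i)).filter (fun k => k ∈ S) := by
      ext k
      simp only [Finset.mem_filter, Finset.mem_univ, true_and]
      exact ⟨fun h => ⟨h.2, h.1⟩, fun h => ⟨h.2, h.1⟩⟩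
    rw [hset, Finset.sum_filter]
    refine Finset.sum_congr rfl fun k _ => ?_
    by_cases hk : k ∈ S
    · rw [if_pos hk, if_pos hk, mul_one]
    · rw [if_neg hk, if_neg hk, mul_zero]
  have hstep : ∀ S : Finset κ, wt[g, S] * (mass[lv, a, i, S] : ℝ) =
      ∑ k ∈ Finset.univ.filter (fun k => lv k ≤ i), (a k : ℝ) * (wt[g, S] * (if k ∈ S then (1 : ℝ) else 0)) := by
    intro S
    rw [hmass S, Finset.mul_sum]
    exact Finset.sum_congr rfl fun k _ => by ring
  rw [Finset.sum_congr rfl fun S _ => hstep S, Finset.sum_comm]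
  refine Finset.sum_congr rfl fun k _ => ?_
  rw [← Finset.mul_sum, sum_wt_mem g k]

/-- **The mean of the block-comb count**: `Σ_i pd i·Σ_S wt S·mass_i S = Σ_k a k·(∏_{i<lv k} q i)·g k` (live levels `≤ D`). [folklore] -/
theorem tail_mean_eq (D : ℕ) (q : ℕ → ℝ) (lv : κ → ℕ) (a : κ → ℕ) (g : κ → ℝ)
    (hlv : ∀ k, 0 < a k → lv k ≤ D) :
    ∑ i ∈ Finset.range (D + 1), pd[D, q, i] * ∑ S : Finset κ, wt[g, S] * (mass[lv, a, i, S] : ℝ) =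
      ∑ k, (a k : ℝ) * ((∏ i ∈ Finset.range (lv k), q i) * g k) := by
  have hin : ∀ i : ℕ, ∑ S : Finset κ, wt[g, S] * (mass[lv, a, i, S] : ℝ) =
      ∑ k, (if lv k ≤ i then (a k : ℝ) * g k else 0) := by
    intro i
    rw [sum_wt_mass_cast, Finset.sum_filter]
  have hswap : ∑ i ∈ Finset.range (D + 1), pd[D, q, i] * ∑ S : Finset κ, wt[g, S] * (mass[lv, a, i, S] : ℝ) =
      ∑ i ∈ Finset.range (D + 1), ∑ k, pd[D, q, i] * (if lv k ≤ i then (a k : ℝ) * g k else 0) := by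
    refine Finset.sum_congr rfl fun i _ => ?_
    rw [hin i, Finset.mul_sum]
  rw [hswap, Finset.sum_comm]
  refine Finset.sum_congr rfl fun k _ => ?_
  by_cases hk : 0 < a k
  · have hlk := hlv k hk
    rw [← pd_tail_sum q D (lv k) hlk, Finset.sum_filter, Finset.sum_mul, Finset.mul_sum]
    refine Finset.sum_congr rfl fun i _ => ?_
    split_ifs <;> ring
  · have h0 : a k = 0 := by omega
    rw [h0]
    simp

/-- **Markov for the closed mass (canonical form).**  With `n = Σ a > j`:  `(EN − j)/(n − j) ≤ TAIL`, because pointwise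
`𝟙[N ≥ j+1] ≥ (N − j)/(n − j)` (`N ≤ n`).  Consequently FAR holds in the MARKOV REGIME `x·(n − j) ≤ j` as soon as `EN > 2j`
(`Quant.farRelayRow_instance_of_markov` read on the block-comb). [this work] -/
theorem tail_ge_mean_markov (D : ℕ) (q : ℕ → ℝ) (hq : ∀ i, 0 ≤ q i ∧ q i ≤ 1) (lv : κ → ℕ) (a : κ → ℕ)
    (g : κ → ℝ) (hg : ∀ k, 0 ≤ g k ∧ g k ≤ 1) (j : ℕ) (hlv : ∀ k, 0 < a k → lv k ≤ D)
    (hnj : (j : ℝ) < ∑ k, (a k : ℝ)) :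
    ((∑ k, (a k : ℝ) * ((∏ i ∈ Finset.range (lv k), q i) * g k)) - j) / ((∑ k, (a k : ℝ)) - j) ≤
      TAIL[D, q, lv, a, g, j] := by
  set n : ℝ := ∑ k, (a k : ℝ) with hn
  have hnj' : 0 < n - j := sub_pos.2 hnj
  -- pointwise comparison of the indicator with the Markov ratio
  have hpt : ∀ (i : ℕ) (S : Finset κ),
      ((mass[lv, a, i, S] : ℝ) - j) / (n - j) ≤ (if j + 1 ≤ mass[lv, a, i, S] then (1 : ℝ) else 0) := by
    intro i S
    have hsub : S.filter (fun k => lv k ≤ i) ⊆ (Finset.univ : Finset κ) := Finset.subset_univ _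
    have hleN : mass[lv, a, i, S] ≤ ∑ k, a k := Finset.sum_le_sum_of_subset hsub
    have hle : (mass[lv, a, i, S] : ℝ) ≤ n := by
      rw [hn]
      exact_mod_cast hleN
    split_ifs with h
    · rw [div_le_one hnj']
      linarith
    · have hlt : mass[lv, a, i, S] ≤ j := by omega
      have hlt' : (mass[lv, a, i, S] : ℝ) ≤ j := by exact_mod_cast hlt
      rw [div_le_iff₀ hnj', zero_mul]
      linarith
  -- the lower sum equals `(EN − j)/(n − j)`
  -- total configuration weight (`Quant.BlockComb.sum_wt_eq_one` of `…QuantBlockCombTail`, re-derived to keep the import light)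
  have hwt1 : ∑ S : Finset κ, wt[g, S] = 1 := by
    rw [← Finset.powerset_univ, IndepBlob.sum_powerset_prod_ite_mem]
    exact Finset.prod_eq_one fun k _ => by ring
  have hinner : ∀ i : ℕ, ∑ S : Finset κ, wt[g, S] * (((mass[lv, a, i, S] : ℝ) - j) / (n - j)) =
      (∑ S : Finset κ, wt[g, S] * (mass[lv, a, i, S] : ℝ)) / (n - j) - j / (n - j) := by
    intro i
    have h1 : ∀ S : Finset κ, wt[g, S] * (((mass[lv, a, i, S] : ℝ) - j) / (n - j)) =
        wt[g, S] * (mass[lv, a, i, S] : ℝ) / (n - j) - wt[g, S] * (j / (n - j)) := fun S => by ring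
    rw [Finset.sum_congr rfl fun S _ => h1 S, Finset.sum_sub_distrib, ← Finset.sum_div, ← Finset.sum_mul,
      hwt1, one_mul]
  have houter : ∑ i ∈ Finset.range (D + 1), pd[D, q, i] *
      ∑ S : Finset κ, wt[g, S] * (((mass[lv, a, i, S] : ℝ) - j) / (n - j)) =
        ((∑ k, (a k : ℝ) * ((∏ i ∈ Finset.range (lv k), q i) * g k)) - j) / (n - j) := by
    have h1 : ∀ i : ℕ, pd[D, q, i] * ∑ S : Finset κ, wt[g, S] * (((mass[lv, a, i, S] : ℝ) - j) / (n - j)) =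
        pd[D, q, i] * (∑ S : Finset κ, wt[g, S] * (mass[lv, a, i, S] : ℝ)) / (n - j) - pd[D, q, i] * (j / (n - j)) := by
      intro i
      rw [hinner i]
      ring
    rw [Finset.sum_congr rfl fun i _ => h1 i, Finset.sum_sub_distrib, ← Finset.sum_div, ← Finset.sum_mul,
      sum_pd_total D q, one_mul, tail_mean_eq D q lv a g hlv]
    ring
  rw [← houter]
  exact Finset.sum_le_sum fun i _ => mul_le_mul_of_nonneg_left
    (Finset.sum_le_sum fun S _ => mul_le_mul_of_nonneg_left (hpt i S) (wt_nonneg g hg S)) (pd_nonneg D q hq i)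


/-! ### 3. The floor-preserving merge of a tied root blob -/

/-- **Floor-preserving merge.**  Gates in `[0,1]`; every live marginal `≥ x`; a live ROOT blob `τ` with `g τ = x`, `j ≤ x·(Σ a − a τ)`
and `a τ < Σ a`.  Then some size vector `aT` (the sizes after moving `τ` into another live blob) has: live set inside the old one, exactly
one live blob fewer, mean `Σ aT·marginal ≥ Σ a·marginal`, and `TAIL[aT] ≤ TAIL[a]`. [this work] -/
theorem merge_tied_root (D : ℕ) (q : ℕ → ℝ) (hq : ∀ i, 0 ≤ q i ∧ q i ≤ 1) (lv : κ → ℕ) (a : κ → ℕ)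
    (g : κ → ℝ) (hg : ∀ k, 0 ≤ g k ∧ g k ≤ 1) (j : ℕ) (x : ℝ)
    (hmarg : ∀ k, 0 < a k → x ≤ (∏ i ∈ Finset.range (lv k), q i) * g k)
    (τ : κ) (hτ : 0 < a τ) (hτ0 : lv τ = 0) (hgτ : g τ = x)
    (hM : (j : ℝ) ≤ x * ((∑ k, (a k : ℝ)) - a τ)) (hlt : (a τ : ℝ) < ∑ k, (a k : ℝ)) :
    ∃ aT : κ → ℕ, (∀ k, 0 < aT k → 0 < a k) ∧
      (Finset.univ.filter (fun k => 0 < aT k)).card + 1 = (Finset.univ.filter (fun k => 0 < a k)).card ∧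
      (∑ k, (a k : ℝ) * ((∏ i ∈ Finset.range (lv k), q i) * g k) ≤
        ∑ k, (aT k : ℝ) * ((∏ i ∈ Finset.range (lv k), q i) * g k)) ∧
      TAIL[D, q, lv, aT, g, j] ≤ TAIL[D, q, lv, a, g, j] := by
  set n : ℝ := ∑ k, (a k : ℝ) with hn
  set a₀ := Function.update a τ 0 with ha₀
  have ha₀τ : a₀ τ = 0 := by rw [ha₀, Function.update_self]
  have ha₀ne : ∀ k, k ≠ τ → a₀ k = a k := fun k hk => by rw [ha₀, Function.update_of_ne hk]
  have hsum₀ : ∑ k, ((a₀ k : ℕ) : ℝ) = n - a τ := by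
    have h := sum_update_univ (fun k => (a k : ℝ)) τ ((0 : ℕ) : ℝ)
    have h' : ∀ k, ((a₀ k : ℕ) : ℝ) = Function.update (fun k => (a k : ℝ)) τ ((0 : ℕ) : ℝ) k := by
      intro k
      by_cases hk : k = τ
      · subst hk; simp [ha₀τ]
      · rw [ha₀ne k hk, Function.update_of_ne hk]
    rw [Finset.sum_congr rfl fun k _ => h' k, h, hn]
    push_cast; ring
  have hM' : (j : ℝ) ≤ g τ * ∑ k, ((a₀ k : ℕ) : ℝ) := by rw [hgτ, hsum₀]; exact hM
  have hpos : ∃ k, 0 < a₀ k := by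
    by_contra hnone
    push Not at hnone
    have hzero : ∀ k, k ≠ τ → a k = 0 := fun k hk => by have := hnone k; rw [ha₀ne k hk] at this; omega
    have hnτ : n = a τ := by
      rw [hn, Finset.sum_eq_add_sum_sdiff_singleton_of_mem (Finset.mem_univ τ) (fun k => (a k : ℝ))]
      rw [Finset.sum_eq_zero fun k hk => by
        have hkτ : k ≠ τ := fun h => by rw [Finset.mem_sdiff, Finset.mem_singleton] at hk; exact hk.2 h
        rw [hzero k hkτ]; simp]
      ring
    linarith
  obtain ⟨ℓ, hℓ, hle⟩ := tail_transfer_le D q hq lv a g hg j τ hτ0 hM' hpos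
  have hℓτ : ℓ ≠ τ := by
    rintro rfl
    rw [Function.update_self] at hℓ
    exact lt_irrefl _ hℓ
  have haℓ : 0 < a ℓ := by
    have h := hℓ
    rwa [Function.update_of_ne hℓτ] at h
  set aT := Function.update a₀ ℓ (a₀ ℓ + a τ) with haT
  have haTτ : aT τ = 0 := by rw [haT, Function.update_of_ne hℓτ.symm, ha₀τ]
  have haTne : ∀ k, k ≠ τ → k ≠ ℓ → aT k = a k := fun k hkτ hkℓ => by
    rw [haT, Function.update_of_ne hkℓ, ha₀ne k hkτ]
  have hlive : ∀ k, 0 < aT k → 0 < a k := by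
    intro k hk
    have hkτ : k ≠ τ := fun h => by rw [h, haTτ] at hk; exact lt_irrefl _ hk
    by_cases hkℓ : k = ℓ
    · rw [hkℓ]; exact haℓ
    · rw [← haTne k hkτ hkℓ]; exact hk
  refine ⟨aT, hlive, ?_, ?_, ?_⟩
  · rw [haT, ha₀]; exact card_live_transfer a τ ℓ hℓτ hτ haℓ
  · have h := sum_cast_mul_transfer a (fun k => (∏ i ∈ Finset.range (lv k), q i) * g k) τ ℓ hℓτ
    rw [haT, ha₀, h]
    have hmτ : (∏ i ∈ Finset.range (lv τ), q i) * g τ = x := by rw [hτ0, Finset.prod_range_zero, one_mul, hgτ]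
    have hmℓ : x ≤ (∏ i ∈ Finset.range (lv ℓ), q i) * g ℓ := hmarg ℓ haℓ
    have h5 : (0 : ℝ) ≤ a τ := Nat.cast_nonneg _
    nlinarith [mul_le_mul_of_nonneg_left hmℓ h5]
  · rw [haT, ha₀]; exact hle

end BlockComb

end Quant

end Summit.CriticalPhenomena.PercolationContinuityZ3.Theorems
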